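import Mathlib
import Summits.Ventures.PercRepro2.CrossAPrimeTwoRoutes
import Summits.Ventures.PercRepro2.CrossAPrimeSupport

/-!
# The two-route class on the support: the constant `π̃₁₂` and hypotheses on `supp p`
(blind cell PercRepro2, p5 g36; S4 §2.4 (s) addendum 38 (6))

The two-route theorem `CrossAPrimeTwoRoutes.crossA'so_nonneg_of_twoRoutes` takes the route
dictionary (`hroute`) and the absorption hypotheses (`hsep`) as statements about EVERY
configuration.  To use it for pinned measures `p[e ↦ 0]` / `p[e ↦ 1]` — whose graphs are the
two-route graphs only on the configurations of positive weight — this file proves the same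
theorem with `hroute` / `hsep` required only on `supp p` (the configurations compatible with the
sure and the null edges, `CrossAPrimeSupport.supp`), and at the CONSTANT `π̃₁₂ = p₁ + p₂ − p₁p₂`:
**`crossC_nonneg_of_twoRoutes_supp`** : `0 ≤ crossC p (p₁ + p₂ − p₁p₂)`.  It also exports the
route-mass facts a mixture argument needs: `Dv = 0` (`prob_Dv_eq_zero_supp`),
`xv = p₂ · P(Q_{V₂}, o ∈ K)` (`prob_xv_eq_supp`), `yv = p₁ · P(Q_{V₁}, b ∈ K)`
(`prob_yv_eq_supp`) and the bounds `xv ≤ p₂ · P(Q, o ∈ K, v ∉ K)`, `yv ≤ p₁ · P(Q, b ∈ K, v ∉ K)`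
(`prob_xv_le_supp`, `prob_yv_le_supp`).  The proofs are those of `CrossAPrimeTwoRoutes` with
every set identity taken on the support (`prob_congr_supp`, `prob_inter_supp`).
Own work; standard axioms.
-/

namespace Summit.Ventures.PercRepro2

open LeafRowPendantRootSO CrossAPrimeA2Route CrossAPrimeSupport CrossAPrimeTwoRoutes

namespace CrossAPrimeTwoRoutesSupp

section Tail

variable {V : Type*} {E : Type*} [Fintype E] [DecidableEq E] [DecidableEq V] {R : Type*} [Field R]
  [LinearOrder R] [IsStrictOrderedRing R]
variable {ends : E → Sym2 V}

/-- **The tail bound on the support**: `CrossAPrimeTwoRoutes.tail_bound` with the absorption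
hypothesis `hsep` required only on `supp p`. -/
theorem tail_bound_supp (p : E → R) (hp : IsProbVec p) {τ π₁ : Finset E} {a₁ a₂ v b : V}
    {V₁ : Finset V}
    (hπ₁ : ∀ e ∈ π₁, ∀ x, x ∈ ends e → x = a₁ ∨ x ∈ V₁)
    (hconn₁ : ∀ ω ∈ allOpen π₁, ∀ x ∈ V₁, Conn ends ω a₁ x) (hv₁ : v ∈ V₁)
    (htail : ∀ ω ∈ allOpen τ, Conn ends ω b v)
    (hsep : ∀ ω ∈ supp p, ω ∈ avoidAll ends a₂ {a₁} → ω ∈ connEvent ends a₂ b →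
      Conn ends (forceOpen τ ω) a₂ a₁ → ω ∈ allOpen π₁) :
    (∏ e ∈ τ, p e) *
        (prob p (avoidAll ends a₂ {a₁} ∩ connEvent ends a₂ b) -
          (∏ e ∈ π₁, p e) *
            prob p (avoidAll ends a₂ {a₁} ∩ connEvent ends a₂ b ∩ (connEvent ends a₂ v)ᶜ)) ≤
      prob p (avoidAll ends a₂ {a₁} ∩ connEvent ends a₂ b ∩ connEvent ends a₂ v) := by
  classical
  set Q := avoidAll ends a₂ {a₁} with hQ
  set B := connEvent ends a₂ b
  set Vv := connEvent ends a₂ v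
  set A' : Set (Config E) := {ω | forceOpen τ ω ∈ Q ∩ B ∩ Vv} with hA'
  have hA'dep : DependsOn (· ∈ A') ((↑τ : Set E)ᶜ) := by
    intro ω ω' h
    simp only [hA', Set.mem_setOf_eq]
    rw [forceOpen_eq_of_eqOn h]
  have h1 : prob p (A' ∩ allOpen τ) ≤ prob p (Q ∩ B ∩ Vv) := by
    refine prob_mono hp fun ω hω => ?_
    have := hω.1
    simp only [hA', Set.mem_setOf_eq] at this
    rwa [forceOpen_eq_of_mem_allOpen hω.2] at this
  have h2 : prob p (A' ∩ allOpen τ) = prob p A' * ∏ e ∈ τ, p e :=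
    prob_inter_allOpen p τ hA'dep
  set Abs : Set (Config E) := {ω | Conn ends (forceOpen τ ω) a₂ a₁} with hAbs
  have h3 : Q ∩ B ∩ Absᶜ ⊆ A' := by
    intro ω hω
    simp only [hA', Set.mem_setOf_eq, Set.mem_inter_iff]
    have hle := le_forceOpen τ ω
    refine ⟨⟨?_, conn_mono hle hω.1.2⟩, ?_⟩
    · intro x hx hc
      rw [Finset.mem_singleton] at hx
      rw [hx] at hc
      exact hω.2 hc
    · exact conn_trans (conn_mono hle hω.1.2) (htail _ (forceOpen_mem_allOpen τ ω))
  -- the absorption set, on the support, forces `π₁` open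
  have h4 : Q ∩ B ∩ Abs ∩ supp p ⊆ Q ∩ B ∩ allOpen π₁ := by
    intro ω hω
    exact ⟨hω.1.1, hsep ω hω.2 hω.1.1.1 hω.1.1.2 hω.1.2⟩
  have h5 : prob p (Q ∩ B ∩ allOpen π₁) ≤
      (∏ e ∈ π₁, p e) * prob p (Q ∩ B ∩ Vvᶜ) := by
    rw [prob_Q_conn_allOpen p hπ₁ hconn₁ a₂ b]
    refine mul_le_mul_of_nonneg_left (prob_mono hp fun ω hω => ?_) (Finset.prod_nonneg fun e _ => hp.nonneg e)
    refine ⟨⟨fun x hx => hω.1 x (by rw [Finset.mem_singleton] at hx; rw [hx]; exact Finset.mem_insert_self a₁ V₁), hω.2⟩, ?_⟩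
    exact hω.1 v (Finset.mem_insert_of_mem hv₁)
  have hsplit := prob_inter_add_prob_inter_compl p (Q ∩ B) Abs
  have hA'ge : prob p (Q ∩ B ∩ Absᶜ) ≤ prob p A' := prob_mono hp h3
  have hAbs_le : prob p (Q ∩ B ∩ Abs) ≤ (∏ e ∈ π₁, p e) * prob p (Q ∩ B ∩ Vvᶜ) := by
    rw [← prob_inter_supp p (Q ∩ B ∩ Abs)]
    exact (prob_mono hp h4).trans h5
  have hγ : 0 ≤ ∏ e ∈ τ, p e := Finset.prod_nonneg fun e _ => hp.nonneg e
  have key : prob p (Q ∩ B) - (∏ e ∈ π₁, p e) * prob p (Q ∩ B ∩ Vvᶜ) ≤ prob p A' := by linarith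
  calc (∏ e ∈ τ, p e) * (prob p (Q ∩ B) - (∏ e ∈ π₁, p e) * prob p (Q ∩ B ∩ Vvᶜ))
      ≤ (∏ e ∈ τ, p e) * prob p A' := mul_le_mul_of_nonneg_left key hγ
    _ = prob p (A' ∩ allOpen τ) := by rw [h2, mul_comm]
    _ ≤ prob p (Q ∩ B ∩ Vv) := h1

end Tail

section RouteMasses

variable {V : Type*} {E : Type*} [Fintype E] [DecidableEq E] [DecidableEq V] {R : Type*} [Field R]
  [LinearOrder R] [IsStrictOrderedRing R]
variable {ends : E → Sym2 V}

omit [Fintype E] [DecidableEq E] [DecidableEq V] [LinearOrder R] [IsStrictOrderedRing R] in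
/-- On the support, with the route dictionary, `Q ∩ {a₁ ↔ v} ∩ {o ∈ K} ∩ {b ∈ K}` is empty
(`o ∈ V₁`, `b ∈ V₂`). -/
lemma Dv_inter_supp_eq_empty (p : E → R) {π₁ π₂ : Finset E} {V₁ V₂ : Finset V}
    {o a₁ a₂ v b : V}
    (hconn₁ : ∀ ω ∈ allOpen π₁, ∀ x ∈ V₁, Conn ends ω a₁ x)
    (hconn₂ : ∀ ω ∈ allOpen π₂, ∀ x ∈ V₂, Conn ends ω a₁ x)
    (ho : o ∈ V₁) (hb : b ∈ V₂)
    (hroute : ∀ ω ∈ supp p, ω ∈ avoidAll ends a₂ {a₁} →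
      (ω ∈ connEvent ends a₁ v ↔ ω ∈ allOpen π₁ ∪ allOpen π₂)) :
    avoidAll ends a₂ {a₁} ∩ (connEvent ends a₁ v ∩ (connEvent ends a₂ o ∩ connEvent ends a₂ b)) ∩
      supp p = ∅ ∩ supp p := by
  ext ω
  constructor
  · rintro ⟨⟨hQω, hL, hoK, hbK⟩, hs⟩
    exfalso
    rcases (hroute ω hs hQω).1 hL with h | h
    · exact not_allOpen_of_mem hconn₁ ho hQω hoK h
    · exact not_allOpen_of_mem hconn₂ hb hQω hbK h
  · rintro ⟨h, -⟩
    exact ((Set.mem_empty_iff_false ω).1 h).elim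

omit [DecidableEq V] [LinearOrder R] [IsStrictOrderedRing R] in
/-- `Dv = 0` on the support. -/
lemma prob_Dv_eq_zero_supp (p : E → R) {π₁ π₂ : Finset E} {V₁ V₂ : Finset V}
    {o a₁ a₂ v b : V}
    (hconn₁ : ∀ ω ∈ allOpen π₁, ∀ x ∈ V₁, Conn ends ω a₁ x)
    (hconn₂ : ∀ ω ∈ allOpen π₂, ∀ x ∈ V₂, Conn ends ω a₁ x)
    (ho : o ∈ V₁) (hb : b ∈ V₂)
    (hroute : ∀ ω ∈ supp p, ω ∈ avoidAll ends a₂ {a₁} →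
      (ω ∈ connEvent ends a₁ v ↔ ω ∈ allOpen π₁ ∪ allOpen π₂)) :
    prob p (avoidAll ends a₂ {a₁} ∩
      (connEvent ends a₁ v ∩ (connEvent ends a₂ o ∩ connEvent ends a₂ b))) = 0 := by
  rw [prob_congr_supp p (Dv_inter_supp_eq_empty p hconn₁ hconn₂ ho hb hroute), prob_empty]

omit [Fintype E] [DecidableEq E] [DecidableEq V] [LinearOrder R] [IsStrictOrderedRing R] in
/-- On the support, with the route dictionary and `z` on the other route, the route mass of `z`
is the `π`-open part: `Q ∩ {a₁ ↔ v} ∩ {z ∈ K} = Q ∩ {z ∈ K} ∩ {π open}` (`z ∈ V'`, `π'` the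
route through `z`, `π` the other one). -/
lemma route_inter_supp_eq (p : E → R) {π π' : Finset E} {V' : Finset V} {z a₁ a₂ v : V}
    (hconn' : ∀ ω ∈ allOpen π', ∀ x ∈ V', Conn ends ω a₁ x) (hz : z ∈ V')
    (hroute : ∀ ω ∈ supp p, ω ∈ avoidAll ends a₂ {a₁} →
      (ω ∈ connEvent ends a₁ v ↔ ω ∈ allOpen π' ∪ allOpen π)) :
    avoidAll ends a₂ {a₁} ∩ (connEvent ends a₁ v ∩ connEvent ends a₂ z) ∩ supp p =
      avoidAll ends a₂ {a₁} ∩ connEvent ends a₂ z ∩ allOpen π ∩ supp p := by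
  ext ω
  simp only [Set.mem_inter_iff]
  constructor
  · rintro ⟨⟨hQω, hL, hzK⟩, hs⟩
    refine ⟨⟨⟨hQω, hzK⟩, ?_⟩, hs⟩
    rcases (hroute ω hs hQω).1 hL with h | h
    · exact absurd h (not_allOpen_of_mem hconn' hz hQω hzK)
    · exact h
  · rintro ⟨⟨⟨hQω, hzK⟩, hπ⟩, hs⟩
    exact ⟨⟨hQω, (hroute ω hs hQω).2 (Or.inr hπ), hzK⟩, hs⟩

omit [LinearOrder R] [IsStrictOrderedRing R] in
/-- `xv = p₂ · P(Q_{V₂}, o ∈ K)` on the support (`o ∈ V₁`). -/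
lemma prob_xv_eq_supp (p : E → R) {π₁ π₂ : Finset E} {V₁ V₂ : Finset V} {o a₁ a₂ v : V}
    (hπ₂ : ∀ e ∈ π₂, ∀ x, x ∈ ends e → x = a₁ ∨ x ∈ V₂)
    (hconn₁ : ∀ ω ∈ allOpen π₁, ∀ x ∈ V₁, Conn ends ω a₁ x)
    (hconn₂ : ∀ ω ∈ allOpen π₂, ∀ x ∈ V₂, Conn ends ω a₁ x) (ho : o ∈ V₁)
    (hroute : ∀ ω ∈ supp p, ω ∈ avoidAll ends a₂ {a₁} →
      (ω ∈ connEvent ends a₁ v ↔ ω ∈ allOpen π₁ ∪ allOpen π₂)) :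
    prob p (avoidAll ends a₂ {a₁} ∩ (connEvent ends a₁ v ∩ connEvent ends a₂ o)) =
      (∏ e ∈ π₂, p e) * prob p (avoidAll ends a₂ (insert a₁ V₂) ∩ connEvent ends a₂ o) := by
  rw [prob_congr_supp p (route_inter_supp_eq p hconn₁ ho hroute)]
  exact prob_Q_conn_allOpen p hπ₂ hconn₂ a₂ o

omit [LinearOrder R] [IsStrictOrderedRing R] in
/-- `yv = p₁ · P(Q_{V₁}, b ∈ K)` on the support (`b ∈ V₂`). -/
lemma prob_yv_eq_supp (p : E → R) {π₁ π₂ : Finset E} {V₁ V₂ : Finset V} {a₁ a₂ v b : V}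
    (hπ₁ : ∀ e ∈ π₁, ∀ x, x ∈ ends e → x = a₁ ∨ x ∈ V₁)
    (hconn₁ : ∀ ω ∈ allOpen π₁, ∀ x ∈ V₁, Conn ends ω a₁ x)
    (hconn₂ : ∀ ω ∈ allOpen π₂, ∀ x ∈ V₂, Conn ends ω a₁ x) (hb : b ∈ V₂)
    (hroute : ∀ ω ∈ supp p, ω ∈ avoidAll ends a₂ {a₁} →
      (ω ∈ connEvent ends a₁ v ↔ ω ∈ allOpen π₁ ∪ allOpen π₂)) :
    prob p (avoidAll ends a₂ {a₁} ∩ (connEvent ends a₁ v ∩ connEvent ends a₂ b)) =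
      (∏ e ∈ π₁, p e) * prob p (avoidAll ends a₂ (insert a₁ V₁) ∩ connEvent ends a₂ b) := by
  have hroute' : ∀ ω ∈ supp p, ω ∈ avoidAll ends a₂ {a₁} →
      (ω ∈ connEvent ends a₁ v ↔ ω ∈ allOpen π₂ ∪ allOpen π₁) := by
    intro ω hs hQ
    rw [hroute ω hs hQ, Set.union_comm]
  rw [prob_congr_supp p (route_inter_supp_eq p hconn₂ hb hroute')]
  exact prob_Q_conn_allOpen p hπ₁ hconn₁ a₂ b

/-- The avoiding mass is below the `v ∉ K` mass: `P(Q_W, z ∈ K) ≤ P(Q, z ∈ K, v ∉ K)` for `v ∈ W`. -/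
lemma prob_avoid_le_notConn (p : E → R) (hp : IsProbVec p) {W : Finset V} {a₁ a₂ v z : V}
    (hv : v ∈ W) :
    prob p (avoidAll ends a₂ (insert a₁ W) ∩ connEvent ends a₂ z) ≤
      prob p (avoidAll ends a₂ {a₁} ∩ connEvent ends a₂ z ∩ (connEvent ends a₂ v)ᶜ) := by
  refine prob_mono hp fun ω hω => ?_
  refine ⟨⟨fun x hx => hω.1 x (by rw [Finset.mem_singleton] at hx; rw [hx]; exact Finset.mem_insert_self a₁ W), hω.2⟩, ?_⟩
  exact hω.1 v (Finset.mem_insert_of_mem hv)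

/-- `xv ≤ p₂ · P(Q, o ∈ K, v ∉ K)` on the support. -/
lemma prob_xv_le_supp (p : E → R) (hp : IsProbVec p) {π₁ π₂ : Finset E} {V₁ V₂ : Finset V}
    {o a₁ a₂ v : V}
    (hπ₂ : ∀ e ∈ π₂, ∀ x, x ∈ ends e → x = a₁ ∨ x ∈ V₂)
    (hconn₁ : ∀ ω ∈ allOpen π₁, ∀ x ∈ V₁, Conn ends ω a₁ x)
    (hconn₂ : ∀ ω ∈ allOpen π₂, ∀ x ∈ V₂, Conn ends ω a₁ x) (ho : o ∈ V₁) (hv₂ : v ∈ V₂)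
    (hroute : ∀ ω ∈ supp p, ω ∈ avoidAll ends a₂ {a₁} →
      (ω ∈ connEvent ends a₁ v ↔ ω ∈ allOpen π₁ ∪ allOpen π₂)) :
    prob p (avoidAll ends a₂ {a₁} ∩ (connEvent ends a₁ v ∩ connEvent ends a₂ o)) ≤
      (∏ e ∈ π₂, p e) *
        prob p (avoidAll ends a₂ {a₁} ∩ connEvent ends a₂ o ∩ (connEvent ends a₂ v)ᶜ) := by
  rw [prob_xv_eq_supp p hπ₂ hconn₁ hconn₂ ho hroute]
  exact mul_le_mul_of_nonneg_left (prob_avoid_le_notConn p hp hv₂)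
    (Finset.prod_nonneg fun e _ => hp.nonneg e)

/-- `yv ≤ p₁ · P(Q, b ∈ K, v ∉ K)` on the support. -/
lemma prob_yv_le_supp (p : E → R) (hp : IsProbVec p) {π₁ π₂ : Finset E} {V₁ V₂ : Finset V}
    {a₁ a₂ v b : V}
    (hπ₁ : ∀ e ∈ π₁, ∀ x, x ∈ ends e → x = a₁ ∨ x ∈ V₁)
    (hconn₁ : ∀ ω ∈ allOpen π₁, ∀ x ∈ V₁, Conn ends ω a₁ x)
    (hconn₂ : ∀ ω ∈ allOpen π₂, ∀ x ∈ V₂, Conn ends ω a₁ x) (hb : b ∈ V₂) (hv₁ : v ∈ V₁)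
    (hroute : ∀ ω ∈ supp p, ω ∈ avoidAll ends a₂ {a₁} →
      (ω ∈ connEvent ends a₁ v ↔ ω ∈ allOpen π₁ ∪ allOpen π₂)) :
    prob p (avoidAll ends a₂ {a₁} ∩ (connEvent ends a₁ v ∩ connEvent ends a₂ b)) ≤
      (∏ e ∈ π₁, p e) *
        prob p (avoidAll ends a₂ {a₁} ∩ connEvent ends a₂ b ∩ (connEvent ends a₂ v)ᶜ) := by
  rw [prob_yv_eq_supp p hπ₁ hconn₁ hconn₂ hb hroute]
  exact mul_le_mul_of_nonneg_left (prob_avoid_le_notConn p hp hv₁)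
    (Finset.prod_nonneg fun e _ => hp.nonneg e)

end RouteMasses

section Main

variable {V : Type*} {E : Type*} [Fintype E] [DecidableEq E] [DecidableEq V] {R : Type*} [Field R]
  [LinearOrder R] [IsStrictOrderedRing R]
variable {ends : E → Sym2 V}

/-- **The two-route class on the support, at the constant `π̃₁₂ = p₁ + p₂ − p₁p₂`** (hard case
`o ∈ V₁`, `b ∈ V₂`): `CrossAPrimeTwoRoutes.crossA'so_nonneg_of_twoRoutes` with `hroute`, `hsep₁`,
`hsep₂` required only on `supp p`, concluding `0 ≤ crossC p (p₁ + p₂ − p₁p₂)`. -/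
theorem crossC_nonneg_of_twoRoutes_supp (p : E → R) (hp : IsProbVec p)
    {π₁ π₂ τ₁ τ₂ : Finset E} {V₁ V₂ : Finset V} {o a₁ a₂ v b : V}
    (hπ₁ : ∀ e ∈ π₁, ∀ x, x ∈ ends e → x = a₁ ∨ x ∈ V₁)
    (hπ₂ : ∀ e ∈ π₂, ∀ x, x ∈ ends e → x = a₁ ∨ x ∈ V₂)
    (hconn₁ : ∀ ω ∈ allOpen π₁, ∀ x ∈ V₁, Conn ends ω a₁ x)
    (hconn₂ : ∀ ω ∈ allOpen π₂, ∀ x ∈ V₂, Conn ends ω a₁ x)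
    (hv₁ : v ∈ V₁) (hv₂ : v ∈ V₂) (ho : o ∈ V₁) (hb : b ∈ V₂)
    (hroute : ∀ ω ∈ supp p, ω ∈ avoidAll ends a₂ {a₁} →
      (ω ∈ connEvent ends a₁ v ↔ ω ∈ allOpen π₁ ∪ allOpen π₂))
    (hτ₁ : τ₁ ⊆ π₁) (hτ₂ : τ₂ ⊆ π₂)
    (htail₁ : ∀ ω ∈ allOpen τ₁, Conn ends ω o v) (htail₂ : ∀ ω ∈ allOpen τ₂, Conn ends ω b v)
    (hsep₁ : ∀ ω ∈ supp p, ω ∈ avoidAll ends a₂ {a₁} → ω ∈ connEvent ends a₂ o →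
      Conn ends (forceOpen τ₁ ω) a₂ a₁ → ω ∈ allOpen π₂)
    (hsep₂ : ∀ ω ∈ supp p, ω ∈ avoidAll ends a₂ {a₁} → ω ∈ connEvent ends a₂ b →
      Conn ends (forceOpen τ₂ ω) a₂ a₁ → ω ∈ allOpen π₁) :
    0 ≤ crossC p (∏ e ∈ π₁, p e + ∏ e ∈ π₂, p e - (∏ e ∈ π₁, p e) * ∏ e ∈ π₂, p e)
      ends o a₁ a₂ v b := by
  classical
  set p₁ := ∏ e ∈ π₁, p e with hp₁def
  set p₂ := ∏ e ∈ π₂, p e with hp₂def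
  have hp₁0 : 0 ≤ p₁ := Finset.prod_nonneg fun e _ => hp.nonneg e
  have hp₂0 : 0 ≤ p₂ := Finset.prod_nonneg fun e _ => hp.nonneg e
  have hp₁1 : p₁ ≤ 1 := Finset.prod_le_one (fun e _ => hp.nonneg e) (fun e _ => hp.le_one e)
  have hp₂1 : p₂ ≤ 1 := Finset.prod_le_one (fun e _ => hp.nonneg e) (fun e _ => hp.le_one e)
  set Q := avoidAll ends a₂ {a₁} with hQ
  set oH := connEvent ends a₂ o
  set bH := connEvent ends a₂ b
  set vH := connEvent ends a₂ v
  set L := connEvent ends a₁ v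
  have hDv : prob p (Q ∩ (L ∩ (oH ∩ bH))) = 0 :=
    prob_Dv_eq_zero_supp p hconn₁ hconn₂ ho hb hroute
  have hxv : prob p (Q ∩ (L ∩ oH)) =
      p₂ * prob p (avoidAll ends a₂ (insert a₁ V₂) ∩ oH) :=
    prob_xv_eq_supp p hπ₂ hconn₁ hconn₂ ho hroute
  have hyv : prob p (Q ∩ (L ∩ bH)) =
      p₁ * prob p (avoidAll ends a₂ (insert a₁ V₁) ∩ bH) :=
    prob_yv_eq_supp p hπ₁ hconn₁ hconn₂ hb hroute
  set x := prob p (Q ∩ oH) with hxdef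
  set y := prob p (Q ∩ bH) with hydef
  set x₂ := prob p (avoidAll ends a₂ (insert a₁ V₂) ∩ oH) with hx₂def
  set y₁ := prob p (avoidAll ends a₂ (insert a₁ V₁) ∩ bH) with hy₁def
  set d_b := prob p (Q ∩ bH ∩ vHᶜ) with hdbdef
  set d_o := prob p (Q ∩ oH ∩ vHᶜ) with hdodef
  have hy₁ : y₁ ≤ d_b := prob_avoid_le_notConn p hp hv₁
  have hx₂ : x₂ ≤ d_o := prob_avoid_le_notConn p hp hv₂
  have hγ₂ : p₂ ≤ ∏ e ∈ τ₂, p e := by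
    rw [hp₂def, ← Finset.prod_sdiff hτ₂]
    have h1 : ∏ e ∈ π₂ \ τ₂, p e ≤ 1 :=
      Finset.prod_le_one (fun e _ => hp.nonneg e) (fun e _ => hp.le_one e)
    have h2 : 0 ≤ ∏ e ∈ τ₂, p e := Finset.prod_nonneg fun e _ => hp.nonneg e
    have := mul_le_mul_of_nonneg_left h1 h2
    linarith
  have hγ₁ : p₁ ≤ ∏ e ∈ τ₁, p e := by
    rw [hp₁def, ← Finset.prod_sdiff hτ₁]
    have h1 : ∏ e ∈ π₁ \ τ₁, p e ≤ 1 :=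
      Finset.prod_le_one (fun e _ => hp.nonneg e) (fun e _ => hp.le_one e)
    have h2 : 0 ≤ ∏ e ∈ τ₁, p e := Finset.prod_nonneg fun e _ => hp.nonneg e
    have := mul_le_mul_of_nonneg_left h1 h2
    linarith
  have hγ₂1 : ∏ e ∈ τ₂, p e ≤ 1 :=
    Finset.prod_le_one (fun e _ => hp.nonneg e) (fun e _ => hp.le_one e)
  have hγ₁1 : ∏ e ∈ τ₁, p e ≤ 1 :=
    Finset.prod_le_one (fun e _ => hp.nonneg e) (fun e _ => hp.le_one e)
  have htb := tail_bound_supp p hp hπ₁ hconn₁ hv₁ htail₂ hsep₂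
  have hto := tail_bound_supp p hp hπ₂ hconn₂ hv₂ htail₁ hsep₁
  have hsplit_b := prob_inter_add_prob_inter_compl p (Q ∩ bH) vH
  have hsplit_o := prob_inter_add_prob_inter_compl p (Q ∩ oH) vH
  have hb' : d_b * (1 - (∏ e ∈ τ₂, p e) * p₁) ≤ y * (1 - ∏ e ∈ τ₂, p e) := by
    rw [← hp₁def] at htb
    linarith [htb, hsplit_b]
  have ho' : d_o * (1 - (∏ e ∈ τ₁, p e) * p₂) ≤ x * (1 - ∏ e ∈ τ₁, p e) := by
    rw [← hp₂def] at hto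
    linarith [hto, hsplit_o]
  have hx0 : 0 ≤ x := prob_nonneg hp _
  have hy0 : 0 ≤ y := prob_nonneg hp _
  have hdby : d_b ≤ y := prob_mono hp Set.inter_subset_left
  have hdox : d_o ≤ x := prob_mono hp Set.inter_subset_left
  have hrb : d_b * (1 - p₁ * p₂) ≤ y * (1 - p₂) :=
    tail_to_route hp₁0 hp₁1 hp₂0 hγ₂ hγ₂1 hy0 hdby hb'
  have hro : d_o * (1 - p₂ * p₁) ≤ x * (1 - p₁) :=
    tail_to_route hp₂0 hp₂1 hp₁0 hγ₁ hγ₁1 hx0 hdox ho'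
  have hro' : d_o * (1 - p₁ * p₂) ≤ x * (1 - p₁) := by rw [mul_comm p₁ p₂]; exact hro
  have hx1 : x ≤ 1 - p₁ := prob_Q_conn_le_one_sub p hp hconn₁ ho a₂
  have hy1 : y ≤ 1 - p₂ := prob_Q_conn_le_one_sub p hp hconn₂ hb a₂
  have halg := two_routes_algebra hp₁0 hp₁1 hp₂0 hp₂1 hx0 hy0 hrb hro' hx1 hy1
  unfold crossC
  rw [hDv, hxv, hyv]
  have k1 : p₂ * y * x₂ ≤ p₂ * y * d_o := mul_le_mul_of_nonneg_left hx₂ (mul_nonneg hp₂0 hy0)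
  have k2 : p₁ * x * y₁ ≤ p₁ * x * d_b := mul_le_mul_of_nonneg_left hy₁ (mul_nonneg hp₁0 hx0)
  linarith [halg, k1, k2]

/-- The sign of `crossA′so` in the two-route class with hypotheses on the support. -/
theorem crossA'so_nonneg_of_twoRoutes_supp (p : E → R) (hp : IsProbVec p)
    {π₁ π₂ τ₁ τ₂ : Finset E} {V₁ V₂ : Finset V} {o a₁ a₂ v b : V}
    (hd : Disjoint π₁ π₂)
    (hπ₁ : ∀ e ∈ π₁, ∀ x, x ∈ ends e → x = a₁ ∨ x ∈ V₁)
    (hπ₂ : ∀ e ∈ π₂, ∀ x, x ∈ ends e → x = a₁ ∨ x ∈ V₂)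
    (hconn₁ : ∀ ω ∈ allOpen π₁, ∀ x ∈ V₁, Conn ends ω a₁ x)
    (hconn₂ : ∀ ω ∈ allOpen π₂, ∀ x ∈ V₂, Conn ends ω a₁ x)
    (hv₁ : v ∈ V₁) (hv₂ : v ∈ V₂) (ho : o ∈ V₁) (hb : b ∈ V₂)
    (hroute : ∀ ω ∈ supp p, ω ∈ avoidAll ends a₂ {a₁} →
      (ω ∈ connEvent ends a₁ v ↔ ω ∈ allOpen π₁ ∪ allOpen π₂))
    (hτ₁ : τ₁ ⊆ π₁) (hτ₂ : τ₂ ⊆ π₂)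
    (htail₁ : ∀ ω ∈ allOpen τ₁, Conn ends ω o v) (htail₂ : ∀ ω ∈ allOpen τ₂, Conn ends ω b v)
    (hsep₁ : ∀ ω ∈ supp p, ω ∈ avoidAll ends a₂ {a₁} → ω ∈ connEvent ends a₂ o →
      Conn ends (forceOpen τ₁ ω) a₂ a₁ → ω ∈ allOpen π₂)
    (hsep₂ : ∀ ω ∈ supp p, ω ∈ avoidAll ends a₂ {a₁} → ω ∈ connEvent ends a₂ b →
      Conn ends (forceOpen τ₂ ω) a₂ a₁ → ω ∈ allOpen π₁) :
    0 ≤ crossA'so p ends o a₁ a₂ v b := by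
  have hc : ∏ e ∈ π₁, p e + ∏ e ∈ π₂, p e - (∏ e ∈ π₁, p e) * ∏ e ∈ π₂, p e ≤
      prob p (connEvent ends a₁ v) := by
    rw [← prob_allOpen_union p hd]
    refine prob_mono hp fun ω hω => ?_
    rcases hω with h | h
    · exact hconn₁ ω h v hv₁
    · exact hconn₂ ω h v hv₂
  exact crossA'so_nonneg_of_crossC hp o a₁ a₂ v b hc
    (crossC_nonneg_of_twoRoutes_supp p hp hπ₁ hπ₂ hconn₁ hconn₂ hv₁ hv₂ ho hb hroute hτ₁ hτ₂
      htail₁ htail₂ hsep₁ hsep₂)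

end Main

end CrossAPrimeTwoRoutesSupp

end Summit.Ventures.PercRepro2
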